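import Summits.BirchSwinnertonDyer.BirchSwinnertonDyer.Theorems.ResidualThetaTransportAtTwoAwayDefs
import Summits.BirchSwinnertonDyer.BirchSwinnertonDyer.Theorems.ResidualThetaTransportAtTwoResidualSignedLambdaLowerCMAtTwoRhoLayerPairingTower
import Literature.NumberTheory.GaloisRepresentations.ContinuousShapiroLiftCupAdjoint
import Literature.NumberTheory.GaloisRepresentations.LocalKummerTorsion
import HarnessLib

/-!
# Sketch (stub-ideation `stub_cmLambdaLower`, k = 4, gen 19) — H7, the `k`-INCLUSION SQUARE of the value pin `AwayPins.hlocdS`,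
# by ASSUME-THE-OPPOSITE: what the pin bundle `π : OnePairPins` does NOT know (the root-of-unity tower), the twist that exploits it,
# the exact hypothesis that repairs it, and the named assembly of the square from tree lemmas

Cell `bsd-wall`, seat `planner-sidea-stub_cmLambdaLower-4-g19-0`; crux item stmt-BirchSwinnertonDyer-26074 (RTT
`ResidualThetaCountLowerPureAtTwo`), stub `stub_cmLambdaLower` = RSL_g `ResidualSignedLambdaLowerCMAtTwo` (stmt-22608) BY NAME — never re-typed here.
BSD is NOT proved by any of this; RSL_g (22608) and 26074 are OPEN. Nothing here is a Theorems file; 0 `sorry`; new `def`s are sketch-local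
(the level-raising morphism `muLocalIncl := muInclHom|_{Γ_v}` and four `Prop`-valued predicates `ETower`/`ZetaTower`/`HePk`/`PinFields` naming field shapes).

H7 (stub-critic rev 23 S101 (hχt), k-direction; LEAD GLUE-SPEC-g18 T2 (b)): for the pin class `c_{m,k}(x) = red_{2^k}(conj_σ proj_m x)` and a local
class `y ∈ H¹(U_{m,w}, A_ρ[2^k])`,  `⟨c_{m,k+1}(x), ι_* y⟩_{m,2^{k+1}} · 2^{-(k+1)} = ⟨c_{m,k}(x), y⟩_{m,2^k} · 2^{-k}` in `ℚ/ℤ`.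

* §0 arithmetic of the twist (decide).
* §1 roots of unity: odd powers of primitive `2^k`-th roots are primitive; the twist `ζ_k ↦ ζ_k^{1+2^{k-1}}` BREAKS a tower (`twist_breaks_tower`).
* §2 at the level of the value formula `hePk` (the ONLY field of `OnePairPins` constraining `ePk` numerically):
  `htower (e_k([2]a,[2]b) = e_{k+1}(a,b)²)  ⟺  ζ-tower (ζ_{k+1}² = ζ_k)` (`htower_iff_zetaTower`, ⇒ needs one `c` with `t₀ c = 1`);
  ζ-tower ⟹ the MIXED relation `e_{k+1}(a, ι b) = e_k([2] a, b)` on representatives (`ePk_succ_incl_eq`), which is the module identity behind H7;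
  and the assume-the-opposite witness: every `(ζ, ePk)`-field of `OnePairPins` (`PinFields`) is invariant under the odd twist
  `(ζ_k, e_k) ↦ (ζ_k^{u_k}, e_k^{u_k})`, while the tower is not (`pinFields_twist`, `fields_do_not_force_tower`) — so H7 is NOT a consequence of
  `π`'s fields: the Away existence theorem must carry the tower (available where `π` is BUILT: `ThetaTransport.exists_rhoLayerPairing_pinned_of_crux`).
* §3 the `ℚ/ℤ` currency of `hlocdS`: `a.val • 2^{-(k+1)} = b.val • 2^{-k} ⟺ a = 2·b` in `ZMod 2^{k+1}` (`val_nsmul_inv_two_pow_eq_iff`).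
* §4 the square itself, PROVED (0 sorry): (6′) `invAt_cohomologyMap_muLocalIncl` — THE invariant maps along `μ_{p^k}| ⊆ μ_{p^{k+1}}|`
  (`inv^{(p^{k+1})}(ι_* C) = p · inv^{(p^k)}(C)`; transport of the tree's `Prop121vii.invariantMap_muInclHom_compat`, twin of TP2's
  `invAt_cohomologyMap_muLocalPow`); the element identity `muLocalIncl_localPairingOfFun`; **`layerPairingH1Of_incl_compat`** — the GENERIC
  inclusion square `⟨x, g_* y'⟩_{n,p^{k+1}} = p · ⟨f_* x, y'⟩_{n,p^k}` for coefficient maps `f : M| → M'|`, `g : M'| → M|` with `e(a, g b') = e'(f a, b')`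
  (squares (3)+(5) = the tree's MIXED-variance `shapiroLift_cupProduct_coindFin_map_adjoint`, (6′) above); and the `ρ`-instance
  **`pinInclSquare_of_zetaTower`**: H7 in the `ℚ/ℤ` currency of `hlocdS`, for every `X ∈ H¹(Γ_m, T_ρ)`, from `hePk` + the ζ-tower, with the
  level-raising map `ι_k : A_ρ[2^k]| ⟶ A_ρ[2^{k+1}]|` taken as DATA `ιL` with its defining property `hιL` (`ι = id` on `A_ρ`) — packaging `ι` as a
  `TopRep` morphism is routine mathematics but KERNEL-EXPENSIVE here (three packagings hit `(kernel) deterministic timeout`, see the card), so it is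
  deliberately left to the implementer of file (c).

References: [PerrinRiou1994Invent] §3.6.1; [Kato2004Asterisque] §13.8, §14.9; [NeukirchSchmidtWingberg2008] I §4 (1.4.2), I §6 (1.6.4);
[SerreLocalFields1979] XIII §3 Cor. 3; [Nekovar2006] §0.11.
-/

set_option autoImplicit false
set_option linter.dupNamespace false

noncomputable section

open scoped Classical

namespace Summit.BirchSwinnertonDyer.BirchSwinnertonDyer.Cruxes.ResidualThetaCountLowerPureAtTwo.SideaK4G19

open CategoryTheory Field NumberField IsDedekindDomain
  Literature.NumberTheory.EllipticCurves Literature.NumberTheory.GaloisRepresentations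
  Literature.NumberTheory.EllipticCurves.GreenbergSelmer Literature.NumberTheory.EllipticCurves.CyclotomicLayer
  Literature.NumberTheory.GaloisCohomology ZpExtension
  Summit.BirchSwinnertonDyer.BirchSwinnertonDyer.Theorems.ThetaTransport
  Summit.BirchSwinnertonDyer.BirchSwinnertonDyer.Theorems.OnePair

/-! ## §0 The arithmetic of the twist `u_k = 1 + 2^{k-1}` (small cases, `decide`) -/

/-- Level `k = 2 → 3`: `u₃ = 5`, `u₂ = 3`. A level-2 pin value `1` forces the level-3 pin of `ι y` to be `2 · 1 = 2 (mod 8)`; after the twist the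
level-3 side reads `5 · 2 = 2` but the level-2 side transported reads `2 · (3 · 1) = 6 (mod 8)`: the twisted pins are INCONSISTENT (differ by `4/8 = 1/2`). -/
example : ((5 * 2 : ℕ) : ZMod 8) = 2 ∧ ((2 * (3 * 1) : ℕ) : ZMod 8) = 6 ∧ ((5 * 2 : ℕ) : ZMod 8) ≠ ((2 * (3 * 1) : ℕ) : ZMod 8) := by decide

/-- … whereas on EVEN values the twist is invisible levelwise (`u_k · 2q ≡ 2q mod 2^k`): `3·2 ≡ 2 (4)`, `5·2 ≡ 2, 5·6 ≡ 6 (8)`, `9·6 ≡ 6 (16)` — this is why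
`hpair` (place `2`) does not see the twist when `π.pair` is even-valued. -/
example : ((3 * 2 : ℕ) : ZMod 4) = 2 ∧ ((5 * 2 : ℕ) : ZMod 8) = 2 ∧ ((5 * 6 : ℕ) : ZMod 8) = 6 ∧ ((9 * 6 : ℕ) : ZMod 16) = 6 ∧
    ((9 * 14 : ℕ) : ZMod 16) = 14 := by decide

/-- … and `u_{k+1} ≡ u_k (mod 2^{k-1})` but NOT `(mod 2^k)`: `5 ≡ 3 (2)`, `5 ≢ 3 (4)`; `9 ≡ 5 (4)`, `9 ≢ 5 (8)`. -/
example : ((5 : ℕ) : ZMod 2) = ((3 : ℕ) : ZMod 2) ∧ ((5 : ℕ) : ZMod 4) ≠ ((3 : ℕ) : ZMod 4) ∧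
    ((9 : ℕ) : ZMod 4) = ((5 : ℕ) : ZMod 4) ∧ ((9 : ℕ) : ZMod 8) ≠ ((5 : ℕ) : ZMod 8) := by decide

/-! ## §1 Roots of unity: odd twists stay primitive, and break towers -/

section Roots

variable {K : Type*} [CommRing K] [IsDomain K]

omit [IsDomain K] in
/-- An odd power of a primitive `2^k`-th root of unity is primitive. [folklore] -/
theorem isPrimitiveRoot_pow_of_odd {ζ : K} {k u : ℕ} (hζ : IsPrimitiveRoot ζ (2 ^ k)) (hu : Odd u) : IsPrimitiveRoot (ζ ^ u) (2 ^ k) :=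
  hζ.pow_of_coprime u ((Odd.coprime_two_right hu).pow_right k)

/-- `ζ^{2^k} = -1` for a primitive `2^{k+1}`-th root of unity `ζ`. [folklore] -/
theorem pow_two_pow_eq_neg_one {ζ : K} {k : ℕ} (hζ : IsPrimitiveRoot ζ (2 ^ (k + 1))) : ζ ^ (2 ^ k) = -1 :=
  (hζ.pow (pow_pos two_pos (k + 1)) (pow_succ 2 k)).eq_neg_one_of_two_right

/-- **The twist breaks the tower.** If `ζ_{k+2}² = ζ_{k+1}` (a tower step) with `ζ_{k+1}` primitive of order `2^{k+1}`, then the twisted pair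
`ζ'_{k+2} = ζ_{k+2}^{1+2^{k+1}}`, `ζ'_{k+1} = ζ_{k+1}^{1+2^k}` is NOT a tower step (in characteristic `0`): `ζ'_{k+2}² = ζ_{k+1} ≠ -ζ_{k+1} = ζ'_{k+1}`.
[folklore] -/
theorem twist_breaks_tower [CharZero K] {ζ₁ ζ₂ : K} {k : ℕ} (h₁ : IsPrimitiveRoot ζ₁ (2 ^ (k + 1))) (ht : ζ₂ ^ 2 = ζ₁) :
    (ζ₂ ^ (1 + 2 ^ (k + 1))) ^ 2 ≠ ζ₁ ^ (1 + 2 ^ k) := by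
  intro h
  have hl : (ζ₂ ^ (1 + 2 ^ (k + 1))) ^ 2 = ζ₁ := by
    rw [← pow_mul, mul_comm, pow_mul, ht, pow_add, pow_one, h₁.pow_eq_one, mul_one]
  have hr : ζ₁ ^ (1 + 2 ^ k) = -ζ₁ := by
    rw [pow_add, pow_one, pow_two_pow_eq_neg_one h₁, mul_neg_one]
  rw [hl, hr] at h
  exact h₁.ne_zero (pow_ne_zero _ two_ne_zero) (add_self_eq_zero.mp (eq_neg_iff_add_eq_zero.mp h))

end Roots

/-! ## §2 At the level of the value formula `hePk`: tower ⟺ ζ-tower ⟹ the mixed (inclusion) relation; the twist -/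

section ValueFormula

variable (S : Set (PadicAlgCl 2)) (ρ : FramedGaloisRep ℚ ↥(padicCoeffIntegers S) 2)
  (t₀ : ↥(padicCoeffIntegers S) →+ ℤ_[2]) (ζ : ℕ → AlgebraicClosure ℚ)
  (ePk : ∀ k : ℕ, ↥(AddSubgroup.torsionBy (Cofree ρ ↥(padicCoeffField S)) ((2 ^ k : ℕ) : ℤ)) →
    ↥(AddSubgroup.torsionBy (Cofree ρ ↥(padicCoeffField S)) ((2 ^ k : ℕ) : ℤ)) → AlgebraicClosure ℚ)

/-- The tower relation of `rhoLayerPairingPk_succ_compat` / `exists_rhoLayerPairing_pinned_of_crux` (8th component): `e_k([2]a, [2]b) = e_{k+1}(a,b)²`.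
NOT a field of `OnePairPins`. [cite: Kato2004Asterisque, §14.9 (p. 239)] -/
def ETower : Prop :=
  ∀ k (a b : ↥(AddSubgroup.torsionBy (Cofree ρ ↥(padicCoeffField S)) ((2 ^ (k + 1) : ℕ) : ℤ))),
    ePk k ((cofreeTorsionPow S ρ k).hom a) ((cofreeTorsionPow S ρ k).hom b) = ePk (k + 1) a b ^ 2

/-- The compatible-roots relation `ζ_{k+1}² = ζ_k` (7th component of `exists_rhoLayerPairing_pinned_of_crux`). NOT a field of `OnePairPins`
(which only records `hζ : IsPrimitiveRoot (ζ k) (2^k)`). [cite: Nekovar2006, §0.11] -/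
def ZetaTower : Prop := ∀ k, ζ (k + 1) ^ 2 = ζ k

/-- The value formula, exactly the field `OnePairPins.hePk`. [cite: Kato2004Asterisque, §14.9 (p. 239)] -/
def HePk : Prop :=
  ∀ k (s t : Fin 2 → ↥(padicCoeffIntegers S)), ePk k (divPowCofreeMkTorsion S ρ k s) (divPowCofreeMkTorsion S ρ k t) =
    ζ k ^ (PadicInt.toZModPow k (t₀ (s 0 * t 1 - s 1 * t 0))).val

/-- Everything `OnePairPins` records about `(ζ, ePk)` APART from `hpair`: `hζ, hμPk, hadd₁Pk, hadd₂Pk, hgalPk, hePk`.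
[cite: Kato2004Asterisque, §13.8 (pp. 228–229)] -/
def PinFields : Prop :=
  (∀ k, IsPrimitiveRoot (ζ k) (2 ^ k)) ∧ (∀ k a b, ePk k a b ^ (2 ^ k) = 1) ∧
  (∀ k a₁ a₂ b, ePk k (a₁ + a₂) b = ePk k a₁ b * ePk k a₂ b) ∧ (∀ k a b₁ b₂, ePk k a (b₁ + b₂) = ePk k a b₁ * ePk k a b₂) ∧
  (∀ k (σ : absoluteGaloisGroup ℚ) (a b : ↥(AddSubgroup.torsionBy (Cofree ρ ↥(padicCoeffField S)) ((2 ^ k : ℕ) : ℤ))),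
    σ • ePk k a b = ePk k (cofreeTorsionGaloisModule S ρ _ σ a) (cofreeTorsionGaloisModule S ρ _ σ b)) ∧
  HePk S ρ t₀ ζ ePk

variable {S ρ t₀ ζ ePk}

/-- Exponent bookkeeping: `(m mod 2^{k+1}).val ≡ (m mod 2^k).val (mod 2^k)`. [folklore] -/
theorem val_toZModPow_succ_mod (k : ℕ) (m : ℤ_[2]) :
    (PadicInt.toZModPow (k + 1) m).val % 2 ^ k = (PadicInt.toZModPow k m).val := by
  have h := PadicInt.cast_toZModPow k (k + 1) (Nat.le_succ k) m
  rw [ZMod.cast_eq_val] at h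
  rw [← h, ZMod.val_natCast]

/-- `ξ^{(m mod 2^{k+1}).val} = ξ^{(m mod 2^k).val}` whenever `ξ^{2^k} = 1`. [folklore] -/
theorem pow_val_toZModPow_succ {ξ : AlgebraicClosure ℚ} (k : ℕ) (hξ : ξ ^ (2 ^ k) = 1) (m : ℤ_[2]) :
    ξ ^ (PadicInt.toZModPow (k + 1) m).val = ξ ^ (PadicInt.toZModPow k m).val := by
  conv_lhs => rw [← Nat.mod_add_div (PadicInt.toZModPow (k + 1) m).val (2 ^ k), pow_add, pow_mul, hξ, one_pow, mul_one]
  rw [val_toZModPow_succ_mod]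

/-- `(ζ_{k+1}²)^{2^k} = 1`. [folklore] -/
theorem sq_pow_two_pow_eq_one (hζ : ∀ k, IsPrimitiveRoot (ζ k) (2 ^ k)) (k : ℕ) : (ζ (k + 1) ^ 2) ^ (2 ^ k) = 1 := by
  rw [← pow_mul, ← pow_succ', (hζ (k + 1)).pow_eq_one]

/-- `e_k([2] div_{k+1} s, [2] div_{k+1} t) = ζ_k^{(t₀(s∧t) mod 2^k)}` (`cofreeTorsionPow_divPowCofreeMkTorsion` + `hePk`).
[cite: Kato2004Asterisque, §13.8 (p. 228)] -/
theorem ePk_pow_pow_eq (he : HePk S ρ t₀ ζ ePk) (k : ℕ) (s t : Fin 2 → ↥(padicCoeffIntegers S)) :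
    ePk k ((cofreeTorsionPow S ρ k).hom (divPowCofreeMkTorsion S ρ (k + 1) s)) ((cofreeTorsionPow S ρ k).hom (divPowCofreeMkTorsion S ρ (k + 1) t)) =
      ζ k ^ (PadicInt.toZModPow k (t₀ (s 0 * t 1 - s 1 * t 0))).val := by
  rw [cofreeTorsionPow_divPowCofreeMkTorsion, cofreeTorsionPow_divPowCofreeMkTorsion, he]

/-- `e_{k+1}(div_{k+1} s, div_{k+1} t)² = (ζ_{k+1}²)^{(t₀(s∧t) mod 2^k)}`. [cite: Kato2004Asterisque, §14.9 (p. 239)] -/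
theorem sq_ePk_succ_eq (hζ : ∀ k, IsPrimitiveRoot (ζ k) (2 ^ k)) (he : HePk S ρ t₀ ζ ePk) (k : ℕ) (s t : Fin 2 → ↥(padicCoeffIntegers S)) :
    ePk (k + 1) (divPowCofreeMkTorsion S ρ (k + 1) s) (divPowCofreeMkTorsion S ρ (k + 1) t) ^ 2 =
      (ζ (k + 1) ^ 2) ^ (PadicInt.toZModPow k (t₀ (s 0 * t 1 - s 1 * t 0))).val := by
  rw [he, ← pow_mul, mul_comm, pow_mul]
  exact pow_val_toZModPow_succ k (sq_pow_two_pow_eq_one hζ k) _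

/-- **ζ-tower ⟹ tower of pairings** (as in `exists_cofreeWedgeTower_pow`). [cite: Kato2004Asterisque, §14.9 (p. 239)] -/
theorem eTower_of_zetaTower (hζ : ∀ k, IsPrimitiveRoot (ζ k) (2 ^ k)) (he : HePk S ρ t₀ ζ ePk) (hz : ZetaTower ζ) : ETower S ρ ePk := by
  intro k a b
  obtain ⟨s, rfl⟩ := divPowCofreeMkTorsion_surjective S ρ (k + 1) a
  obtain ⟨t, rfl⟩ := divPowCofreeMkTorsion_surjective S ρ (k + 1) b
  rw [ePk_pow_pow_eq he, sq_ePk_succ_eq hζ he, hz k]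

/-- **Tower of pairings ⟹ ζ-tower**, as soon as `t₀` takes the value `1` (it does: `hbO` at `a = 1` and `2 ∉ 𝒪ˣ`; `t₀` generates `Hom_{ℤ₂}(𝒪, ℤ₂)`).
So, GIVEN `hePk`, the tower relation the glue needs and the compatibility of the chosen roots are the SAME datum. [cite: Nekovar2006, §0.11] -/
theorem zetaTower_of_eTower (hζ : ∀ k, IsPrimitiveRoot (ζ k) (2 ^ k)) (he : HePk S ρ t₀ ζ ePk) (hc : ∃ c, t₀ c = 1) (ht : ETower S ρ ePk) :
    ZetaTower ζ := by
  obtain ⟨c, hc⟩ := hc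
  intro k
  rcases Nat.eq_zero_or_pos k with rfl | hk
  · have h0 : ζ 0 = 1 := IsPrimitiveRoot.one_right_iff.mp (by simpa using hζ 0)
    rw [h0]
    simpa using (hζ 1).pow_eq_one
  · have h := ht k (divPowCofreeMkTorsion S ρ (k + 1) ![1, 0]) (divPowCofreeMkTorsion S ρ (k + 1) ![0, c])
    rw [ePk_pow_pow_eq he, sq_ePk_succ_eq hζ he] at h
    have hw : ((![1, 0] : Fin 2 → ↥(padicCoeffIntegers S)) 0 * (![0, c] : Fin 2 → ↥(padicCoeffIntegers S)) 1 -
        (![1, 0] : Fin 2 → ↥(padicCoeffIntegers S)) 1 * (![0, c] : Fin 2 → ↥(padicCoeffIntegers S)) 0) = c := by simp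
    have hv : (PadicInt.toZModPow k (t₀ c)).val = 1 := by
      rw [hc, map_one, ZMod.val_one_eq_one_mod, Nat.mod_eq_of_lt (Nat.one_lt_two_pow (Nat.pos_iff_ne_zero.mp hk))]
    rw [hw, hv, pow_one, pow_one] at h
    exact h.symm

/-- **`ETower ⟺ ZetaTower`** given `hePk` and one `c` with `t₀ c = 1`. [cite: Kato2004Asterisque, §14.9 (p. 239)] [cite: Nekovar2006, §0.11] -/
theorem eTower_iff_zetaTower (hζ : ∀ k, IsPrimitiveRoot (ζ k) (2 ^ k)) (he : HePk S ρ t₀ ζ ePk) (hc : ∃ c, t₀ c = 1) :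
    ETower S ρ ePk ↔ ZetaTower ζ :=
  ⟨zetaTower_of_eTower hζ he hc, eTower_of_zetaTower hζ he⟩

/-- The representative of `ι(div_k t) ∈ A_ρ[2^{k+1}]` is `div_{k+1}(2t)`: `2^{-(k+1)}·(2t) = 2^{-k}·t`. [cite: Kato2004Asterisque, §13.8 (p. 228)] -/
theorem coe_divPowCofreeMkTorsion_succ_two_nsmul (k : ℕ) (t : Fin 2 → ↥(padicCoeffIntegers S)) :
    ((divPowCofreeMkTorsion S ρ (k + 1) (2 • t) : ↥(AddSubgroup.torsionBy (Cofree ρ ↥(padicCoeffField S)) ((2 ^ (k + 1) : ℕ) : ℤ))) :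
        Cofree ρ ↥(padicCoeffField S)) =
      (divPowCofreeMkTorsion S ρ k t : Cofree ρ ↥(padicCoeffField S)) := by
  rw [coe_divPowCofreeMkTorsion_apply, coe_divPowCofreeMkTorsion_apply, map_nsmul, smul_divPowCofreeMk_succ]

/-- **ζ-tower ⟹ THE MIXED (INCLUSION) RELATION on representatives**: `e_{k+1}(div_{k+1} s, ι(div_k t)) = e_k([2] div_{k+1} s, div_k t)`, i.e.
`e_{k+1}(div_{k+1} s, div_{k+1}(2t)) = e_k(div_k s, div_k t)` — the module identity `e_{k+1}(a, ι b) = e_k([2]a, b)` behind H7 (`hc` of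
`shapiroLift_cupProduct_coindFin_map_adjoint`). [cite: Kato2004Asterisque, §14.9 (p. 239)] [cite: NeukirchSchmidtWingberg2008, I §4 (1.4.2)] -/
theorem ePk_succ_incl_eq (hζ : ∀ k, IsPrimitiveRoot (ζ k) (2 ^ k)) (he : HePk S ρ t₀ ζ ePk) (hz : ZetaTower ζ) (k : ℕ)
    (s t : Fin 2 → ↥(padicCoeffIntegers S)) :
    ePk (k + 1) (divPowCofreeMkTorsion S ρ (k + 1) s) (divPowCofreeMkTorsion S ρ (k + 1) (2 • t)) =
      ePk k (divPowCofreeMkTorsion S ρ k s) (divPowCofreeMkTorsion S ρ k t) := by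
  rw [he, he]
  have hw : s 0 * (2 • t) 1 - s 1 * (2 • t) 0 = 2 • (s 0 * t 1 - s 1 * t 0) := by
    simp only [Pi.smul_apply, nsmul_eq_mul, Nat.cast_ofNat]
    ring
  rw [hw, map_nsmul, map_nsmul, two_nsmul, pow_val_add (hζ (k + 1)).pow_eq_one, ← pow_two, ← pow_mul, mul_comm, pow_mul,
    pow_val_toZModPow_succ k (sq_pow_two_pow_eq_one hζ k), hz k]

/-! ### The twist: every `(ζ, ePk)`-field of `OnePairPins` survives `(ζ_k, e_k) ↦ (ζ_k^{u_k}, e_k^{u_k})`, `u_k` odd; the tower does not -/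

/-- The twisting exponents: `u_k = 1 + 2^{k-1}` for `k ≥ 2`, `u_0 = u_1 = 1`. -/
def twistExp (k : ℕ) : ℕ := if 2 ≤ k then 1 + 2 ^ (k - 1) else 1

theorem twistExp_odd (k : ℕ) : Odd (twistExp k) := by
  unfold twistExp
  split_ifs with h
  · rw [add_comm]
    exact Even.add_one ((Nat.even_pow' (Nat.sub_ne_zero_of_lt h)).mpr even_two)
  · exact odd_one

theorem twistExp_two : twistExp 2 = 1 + 2 ^ 1 := by simp [twistExp]

theorem twistExp_three : twistExp 3 = 1 + 2 ^ 2 := by simp [twistExp]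

/-- **The fields survive the twist.** [cite: Kato2004Asterisque, §13.8 (pp. 228–229)] -/
theorem pinFields_twist (u : ℕ → ℕ) (hu : ∀ k, Odd (u k)) (h : PinFields S ρ t₀ ζ ePk) :
    PinFields S ρ t₀ (fun k => ζ k ^ u k) (fun k a b => ePk k a b ^ u k) := by
  obtain ⟨hζ, hμ, hadd₁, hadd₂, hgal, he⟩ := h
  refine ⟨fun k => isPrimitiveRoot_pow_of_odd (hζ k) (hu k), fun k a b => ?_, fun k a₁ a₂ b => ?_, fun k a b₁ b₂ => ?_,
    fun k σ a b => ?_, fun k s t => ?_⟩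
  · beta_reduce
    rw [← pow_mul, mul_comm, pow_mul, hμ, one_pow]
  · beta_reduce
    rw [hadd₁, mul_pow]
  · beta_reduce
    rw [hadd₂, mul_pow]
  · beta_reduce
    rw [show σ • (ePk k a b ^ u k) = (σ • ePk k a b) ^ u k from
      map_pow (MulSemiringAction.toRingHom (absoluteGaloisGroup ℚ) (AlgebraicClosure ℚ) σ) (ePk k a b) (u k), hgal]
  · change ePk k _ _ ^ u k = (ζ k ^ u k) ^ _
    rw [he, ← pow_mul, ← pow_mul, mul_comm]

/-- **ASSUME THE OPPOSITE — refuted: the fields do NOT force the tower.** If some datum satisfies all `(ζ, ePk)`-fields of `OnePairPins` AND the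
tower (the datum `stub_onePairSupply` builds does), then the twisted datum satisfies the same fields and NOT the tower. Hence no proof of `ETower` /
`ZetaTower` from `π : OnePairPins` alone, and none of H7 as soon as one level-`k` pin value `b` is odd (the twisted pins then differ by `b/2 ∈ ℚ/ℤ`,
§0): the Away existence theorem must carry the tower as a HYPOTHESIS — the v3b binder `hζ2 : ∀ k, π.ζ (k+1)^2 = π.ζ k` (LEAD 06:03:29Z).
[cite: Kato2004Asterisque, §14.9 (p. 239)] [cite: Nekovar2006, §0.11] -/
theorem fields_do_not_force_tower (h : ∃ ζ' ePk', PinFields S ρ t₀ ζ' ePk' ∧ ZetaTower ζ') :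
    ∃ ζ' ePk', PinFields S ρ t₀ ζ' ePk' ∧ ¬ ZetaTower ζ' := by
  obtain ⟨ζ', ePk', hP, hT⟩ := h
  refine ⟨fun k => ζ' k ^ twistExp k, fun k a b => ePk' k a b ^ twistExp k, pinFields_twist twistExp twistExp_odd hP,
    fun hT' => twist_breaks_tower (k := 1) (hP.1 2) (hT 2) ?_⟩
  simpa [twistExp] using hT' 2

/-- Under the same hypothesis, `ETower` is not forced either (via `eTower_iff_zetaTower`). [cite: Kato2004Asterisque, §14.9 (p. 239)] -/
theorem fields_do_not_force_eTower (hc : ∃ c, t₀ c = 1) (h : ∃ ζ' ePk', PinFields S ρ t₀ ζ' ePk' ∧ ZetaTower ζ') :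
    ∃ ζ' ePk', PinFields S ρ t₀ ζ' ePk' ∧ ¬ ETower S ρ ePk' := by
  obtain ⟨ζ', ePk', hP, hT⟩ := fields_do_not_force_tower h
  exact ⟨ζ', ePk', hP, fun hE => hT ((eTower_iff_zetaTower hP.1 hP.2.2.2.2.2 hc).mp hE)⟩

end ValueFormula

/-! ## §3 The `ℚ/ℤ` currency of `hlocdS`: `a.val • 2^{-(k+1)} = b.val • 2^{-k}  ⟺  a = 2b (mod 2^{k+1})` -/

section Currency

/-- `2 · 2^{-(k+1)} = 2^{-k}` in `ℚ/ℤ`. [folklore] -/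
theorem two_nsmul_inv_two_pow_succ (k : ℕ) :
    2 • ((((2 : ℚ) ^ (k + 1))⁻¹ : ℚ) : AddCircle (1 : ℚ)) = ((((2 : ℚ) ^ k)⁻¹ : ℚ) : AddCircle (1 : ℚ)) := by
  rw [← AddCircle.coe_nsmul]
  congr 1
  rw [nsmul_eq_mul, pow_succ, mul_inv, Nat.cast_ofNat]
  field_simp

/-- `2^{-k}` has order `2^k` in `ℚ/ℤ`. [folklore] -/
theorem addOrderOf_inv_two_pow (k : ℕ) : addOrderOf ((((2 : ℚ) ^ k)⁻¹ : ℚ) : AddCircle (1 : ℚ)) = 2 ^ k := by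
  have hpos : 0 < 2 ^ k := pow_pos two_pos k
  have h1 := AddCircle.addOrderOf_div_of_gcd_eq_one (p := (1 : ℚ)) (m := 1) hpos (Nat.gcd_one_left _)
  simpa [one_div] using h1

/-- **The currency conversion**: the level-`(k+1)` pin value `a` on `ι y` and the level-`k` pin value `b` on `y` give the SAME element of `ℚ/ℤ` iff
`a = 2 b` in `ZMod 2^{k+1}` — the form in which `localInvariantMap_map_muIncl` (`(inv z).val * (N/a)`) delivers the inclusion square.
[cite: SerreLocalFields1979, XIII §3 Cor. 3] -/
theorem val_nsmul_inv_two_pow_eq_iff (k : ℕ) (a : ZMod (2 ^ (k + 1))) (b : ZMod (2 ^ k)) :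
    a.val • ((((2 : ℚ) ^ (k + 1))⁻¹ : ℚ) : AddCircle (1 : ℚ)) = b.val • ((((2 : ℚ) ^ k)⁻¹ : ℚ) : AddCircle (1 : ℚ)) ↔
      a = ((b.val * 2 : ℕ) : ZMod (2 ^ (k + 1))) := by
  have h2 : b.val • ((((2 : ℚ) ^ k)⁻¹ : ℚ) : AddCircle (1 : ℚ)) = (b.val * 2) • ((((2 : ℚ) ^ (k + 1))⁻¹ : ℚ) : AddCircle (1 : ℚ)) := by
    rw [← two_nsmul_inv_two_pow_succ k, smul_smul]
  rw [h2, nsmul_eq_nsmul_iff_modEq, addOrderOf_inv_two_pow, ← ZMod.natCast_eq_natCast_iff, ZMod.natCast_zmod_val]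

end Currency

/-! ## §4 The inclusion square H7 itself -/

section InclSquare

-- compactness of absolute Galois groups is a LOCAL instance only (same line as `CyclotomicLayerPairingOfFun.lean`)
attribute [local instance] absoluteGaloisGroup_compactSpace

open Summit.BirchSwinnertonDyer.BirchSwinnertonDyer.Theorems Literature.AnabelianGeometry.AbsoluteAnabelian
open Literature.NumberTheory.GaloisRepresentations.DiscreteGaloisModule (mu MuCarrier)

/-! ### §4.1 The level-RAISING morphisms `ι : A_ρ[p^k] ⟶ A_ρ[p^{k+1}]` and `μ_{p^k}| ⟶ μ_{p^{k+1}}|` (sketch-local data; the tree has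
the level-LOWERING `cofreeTorsionPow` / `muLocalPow` and the inclusion into ALL of `A_ρ`, `cofreeTorsionInclusion`) -/

section Incl

variable {p : ℕ} [Fact p.Prime] (S : Set (PadicAlgCl p)) {d : ℕ} (ρ : FramedGaloisRep ℚ ↥(padicCoeffIntegers S) d) (k : ℕ)

/-- `A_ρ[p^k] ⊆ A_ρ[p^{k+1}]`. [cite: Kato2004Asterisque, §13.8 (p. 228)] -/
theorem coe_mem_cofreeTorsionBy_succ (b : ↥(AddSubgroup.torsionBy (Cofree ρ ↥(padicCoeffField S)) ((p ^ k : ℕ) : ℤ))) :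
    (b : Cofree ρ ↥(padicCoeffField S)) ∈ AddSubgroup.torsionBy (Cofree ρ ↥(padicCoeffField S)) ((p ^ (k + 1) : ℕ) : ℤ) := by
  refine (Submodule.mem_torsionBy_iff (R := ℤ) _ _).mpr ?_
  have h : ((p ^ (k + 1) : ℕ) : ℤ) = (p : ℤ) * ((p ^ k : ℕ) : ℤ) := by push_cast; ring
  rw [h, mul_smul, (Submodule.mem_torsionBy_iff (R := ℤ) _ _).mp b.2, smul_zero]

/-- `A_ρ[p^k] ≤ A_ρ[p^{k+1}]` as additive subgroups of `A_ρ` — the inclusion `ι` of H7 is `AddSubgroup.inclusion` of this, as a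
`Γ`-morphism (its packaging as a `TopRep` morphism is left to the implementer: see the card, PLAN 1 step 0). [cite: Kato2004Asterisque, §13.8 (p. 228)] -/
theorem cofreeTorsionBy_pow_le_succ :
    AddSubgroup.torsionBy (Cofree ρ ↥(padicCoeffField S)) ((p ^ k : ℕ) : ℤ) ≤
      AddSubgroup.torsionBy (Cofree ρ ↥(padicCoeffField S)) ((p ^ (k + 1) : ℕ) : ℤ) :=
  fun b hb => coe_mem_cofreeTorsionBy_succ S ρ k ⟨b, hb⟩

variable (v : HeightOneSpectrum (𝓞 ℚ))

/-- **`μ_{p^k}|_{Γ_v} ⟶ μ_{p^{k+1}}|_{Γ_v}`** (the tree's `muInclHom` restricted to `Γ_v`; level-raising twin of TP2's `muLocalPow`).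
[cite: SerreLocalFields1979, XIII §3] -/
def muLocalIncl : muLocalRep (p ^ k) v ⟶ muLocalRep (p ^ (k + 1)) v :=
  TopRep.ofHom ((muInclHom ℚ (Dvd.intro p (SignedKatoOffTwo.LayerPairing.pow_mul_prime_eq k) : p ^ k ∣ p ^ (k + 1))).hom.restrictField
    (v.adicCompletion ℚ))

omit [Fact p.Prime] in
/-- Values of `muLocalIncl`: the identity on underlying units. [cite: SerreLocalFields1979, XIII §3] -/
@[simp] theorem muVal_muLocalIncl (x : MuCarrier ℚ (p ^ k)) :
    muVal ℚ (p ^ (k + 1)) ((muLocalIncl k v).hom x) = muVal ℚ (p ^ k) x := rfl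

/-- `p^{k+1} / p^k = p`. -/
theorem pow_succ_div_pow : p ^ (k + 1) / p ^ k = p := by
  rw [pow_succ, Nat.mul_div_cancel_left p (pow_pos (Fact.out : p.Prime).pos k)]

/-- **(6′) THE invariant maps are compatible along `μ_{p^k} ⊆ μ_{p^{k+1}}`**: `inv^{(p^{k+1})}(ι_* C) = p · inv^{(p^k)}(C)` in `ℤ/p^{k+1}`
(`(1/p^k)ℤ/ℤ ⊆ (1/p^{k+1})ℤ/ℤ`): the tree's `Prop121vii.invariantMap_muInclHom_compat` for `ℚ_v`, transported along `μ(ℚ̄)| ≅ μ(ℚ̄_v)` exactly as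
TP2's `invAt_cohomologyMap_muLocalPow` transports `invLevel_muPowHom`. [cite: SerreLocalFields1979, XIII §3 Cor. 3] -/
theorem invAt_cohomologyMap_muLocalIncl (C : continuousCohomology 2 (muLocalRep (p ^ k) v)) :
    haveI : NeZero (p ^ k) := ⟨pow_ne_zero k (Fact.out : p.Prime).ne_zero⟩
    haveI : NeZero (p ^ (k + 1)) := ⟨pow_ne_zero (k + 1) (Fact.out : p.Prime).ne_zero⟩
    CyclotomicLayer.invAt (p ^ (k + 1)) v (cohomologyMap (muLocalIncl k v) 2 C) =
      (((CyclotomicLayer.invAt (p ^ k) v C).val * p : ℕ) : ZMod (p ^ (k + 1))) := by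
  haveI : NeZero (p ^ k) := ⟨pow_ne_zero k (Fact.out : p.Prime).ne_zero⟩
  haveI : NeZero (p ^ (k + 1)) := ⟨pow_ne_zero (k + 1) (Fact.out : p.Prime).ne_zero⟩
  have hdvd : p ^ k ∣ p ^ (k + 1) := Dvd.intro p (SignedKatoOffTwo.LayerPairing.pow_mul_prime_eq k)
  -- swap `μ(ℚ̄)| ≅ μ(ℚ̄_v)` and the inclusions BEFORE `CharZero ℚ_v` is in context (as in TP2's proof)
  have hpt : ∀ x : MuCarrier ℚ (p ^ k),
      (resIdHom (muLocalIncl k v ≫ (muLocalIso v (p ^ (k + 1))).hom)).hom x =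
        (resIdHom (muInclHom (v.adicCompletion ℚ) hdvd)).hom ((resIdHom (muLocalIso v (p ^ k)).hom).hom x) := fun x => by
    apply muVal_injective (v.adicCompletion ℚ) (p ^ (k + 1))
    change muVal (v.adicCompletion ℚ) (p ^ (k + 1)) (muTransfer ℚ (v.adicCompletion ℚ) (p ^ (k + 1))
        (muInclusion ℚ hdvd x)) =
      muVal (v.adicCompletion ℚ) (p ^ (k + 1)) (muInclusion (v.adicCompletion ℚ) hdvd
        (muTransfer ℚ (v.adicCompletion ℚ) (p ^ k) x))
    rw [muVal_muTransfer, muVal_muInclusion, muVal_muInclusion, muVal_muTransfer]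
  have h1 := map_comp_apply_of (ContinuousMonoidHom.id _) (ContinuousMonoidHom.id _) (ContinuousMonoidHom.id _) (fun _ => rfl)
    (resIdHom (muLocalIncl k v)) (resIdHom (muLocalIso v (p ^ (k + 1))).hom)
    (resIdHom (muLocalIncl k v ≫ (muLocalIso v (p ^ (k + 1))).hom)) (fun _ => rfl) 2 C
  have h2 := map_comp_apply_of (ContinuousMonoidHom.id _) (ContinuousMonoidHom.id _) (ContinuousMonoidHom.id _) (fun _ => rfl)
    (resIdHom (muLocalIso v (p ^ k)).hom) (resIdHom (muInclHom (v.adicCompletion ℚ) hdvd))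
    (resIdHom (muLocalIncl k v ≫ (muLocalIso v (p ^ (k + 1))).hom)) hpt 2 C
  have hswap : (cohomologyMap (muLocalIso v (p ^ (k + 1))).hom 2).hom (cohomologyMap (muLocalIncl k v) 2 C) =
      cohomologyMap (muInclHom (v.adicCompletion ℚ) hdvd) 2 ((cohomologyMap (muLocalIso v (p ^ k)).hom 2).hom C) :=
    h1.symm.trans h2
  haveI : CharZero (v.adicCompletion ℚ) := charZero_adicCompletion v
  unfold CyclotomicLayer.invAt localInvariantMap
  change Prop121vii.invLevel (v.adicCompletion ℚ) (p ^ (k + 1))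
      ((cohomologyMap (muLocalIso v (p ^ (k + 1))).hom 2).hom (cohomologyMap (muLocalIncl k v) 2 C)) =
    (((Prop121vii.invLevel (v.adicCompletion ℚ) (p ^ k) ((cohomologyMap (muLocalIso v (p ^ k)).hom 2).hom C)).val * p : ℕ) :
      ZMod (p ^ (k + 1)))
  rw [hswap, Prop121vii.invariantMap_muInclHom_compat (v.adicCompletion ℚ) hdvd (Prop121vii.invLevel (v.adicCompletion ℚ) (p ^ k))
    (Prop121vii.invLevel (v.adicCompletion ℚ) (p ^ (k + 1))) (Prop121vii.isInvariantMap_invLevel (v.adicCompletion ℚ) (p ^ k))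
    (Prop121vii.isInvariantMap_invLevel (v.adicCompletion ℚ) (p ^ (k + 1))), pow_succ_div_pow]

end Incl

/-! ### §4.2 The GENERIC inclusion square for `layerPairingH1Of` (twin of `ThetaTransport.layerPairingH1Of_succ_compat`, mixed variance) -/

section Generic

variable {p : ℕ} [Fact p.Prime] (k : ℕ) {M M' : Type} [AddCommGroup M] [TopologicalSpace M] [DiscreteTopology M] [Finite M]
  [AddCommGroup M'] [TopologicalSpace M'] [DiscreteTopology M'] [Finite M']
  (ρM : DiscreteGaloisModule ℚ M) (ρM' : DiscreteGaloisModule ℚ M') (v : HeightOneSpectrum (𝓞 ℚ))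
  (fL : localRepOf ρM v ⟶ localRepOf ρM' v) (gL : localRepOf ρM' v ⟶ localRepOf ρM v)
  (e : M → M → AlgebraicClosure ℚ)
  (hμ : ∀ S T, e S T ^ (p ^ (k + 1)) = 1)
  (hadd₁ : ∀ S₁ S₂ T, e (S₁ + S₂) T = e S₁ T * e S₂ T)
  (hadd₂ : ∀ S T₁ T₂, e S (T₁ + T₂) = e S T₁ * e S T₂)
  (hgal : ∀ (σ : absoluteGaloisGroup ℚ) (S T : M), σ • e S T = e (ρM σ S) (ρM σ T))
  (e' : M' → M' → AlgebraicClosure ℚ)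
  (hμ' : ∀ S T, e' S T ^ (p ^ k) = 1)
  (hadd₁' : ∀ S₁ S₂ T, e' (S₁ + S₂) T = e' S₁ T * e' S₂ T)
  (hadd₂' : ∀ S T₁ T₂, e' S (T₁ + T₂) = e' S T₁ * e' S T₂)
  (hgal' : ∀ (σ : absoluteGaloisGroup ℚ) (S T : M'), σ • e' S T = e' (ρM' σ S) (ρM' σ T))
  (hc : ∀ (a : M) (b' : M'), e a (gL.hom b') = e' (fL.hom a) b')
  (κ : ZpExtension ℚ p)

omit [Finite M] [Finite M'] in
include hc in
/-- The MIXED module identity read on the carriers `μ` through `ι : μ_{p^k}| ⟶ μ_{p^{k+1}}|`: `ι⟨f a, b'⟩' = ⟨a, g b'⟩` — hypothesis `hc` of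
`shapiroLift_cupProduct_coindFin_map_adjoint`. [cite: NeukirchSchmidtWingberg2008, I §4 (1.4.2)] -/
theorem muLocalIncl_localPairingOfFun (a : M) (b' : M') :
    haveI : NeZero (p ^ k) := ⟨pow_ne_zero k (Fact.out : p.Prime).ne_zero⟩
    haveI : NeZero (p ^ (k + 1)) := ⟨pow_ne_zero (k + 1) (Fact.out : p.Prime).ne_zero⟩
    (muLocalIncl k v).hom ((localPairingOfFun ρM' (p ^ k) e' hμ' hadd₁' hadd₂' hgal' v).toLin (fL.hom a) b') =
      (localPairingOfFun ρM (p ^ (k + 1)) e hμ hadd₁ hadd₂ hgal v).toLin a (gL.hom b') := by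
  haveI : NeZero (p ^ k) := ⟨pow_ne_zero k (Fact.out : p.Prime).ne_zero⟩
  haveI : NeZero (p ^ (k + 1)) := ⟨pow_ne_zero (k + 1) (Fact.out : p.Prime).ne_zero⟩
  apply muVal_injective ℚ (p ^ (k + 1))
  apply Units.ext
  rw [muVal_muLocalIncl, localPairingOfFun_toLin_apply, localPairingOfFun_toLin_apply]
  change (((MuCarrier.toAdditive (pairingHomOfFun (p ^ k) e' hμ' hadd₁' hadd₂' (fL.hom a) b')).toMul :
      (AlgebraicClosure ℚ)ˣ) : AlgebraicClosure ℚ) =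
    (((MuCarrier.toAdditive (pairingHomOfFun (p ^ (k + 1)) e hμ hadd₁ hadd₂ a (gL.hom b'))).toMul :
      (AlgebraicClosure ℚ)ˣ) : AlgebraicClosure ℚ)
  rw [coe_pairingHomOfFun, coe_pairingHomOfFun]
  exact (hc a b').symm

omit [Finite M] [Finite M'] in
include hc in
/-- **THE GENERIC INCLUSION SQUARE (H7 for coefficient modules).** For local coefficient maps `f : M| → M'|` (think `[p]`), `g : M'| → M|`
(think `ι`) with the mixed identity `e(a, g b') = e'(f a, b')`, levels `p^{k+1}` on `M` and `p^k` on `M'`: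
`⟨x, g_* y'⟩_{n,p^{k+1}} = p · ⟨f_* x, y'⟩_{n,p^k}` in `ℤ/p^{k+1}` on `H¹(U_n, M|) × H¹(U_n, M'|)` — squares (3) Shapiro + (5) summed cup
products in MIXED variance (`shapiroLift_cupProduct_coindFin_map_adjoint`), (6′) invariant maps along the inclusion
(`invAt_cohomologyMap_muLocalIncl`). [cite: PerrinRiou1994Invent, §3.6.1] [cite: NeukirchSchmidtWingberg2008, I §6 (1.6.4), I §4 (1.4.2)]
[cite: SerreLocalFields1979, XIII §3 Cor. 3] -/
theorem layerPairingH1Of_incl_compat (n : ℕ) (x : continuousCohomology 1 (subgroupRep (localRepOf ρM v) (layerGroup κ v n)))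
    (y' : continuousCohomology 1 (subgroupRep (localRepOf ρM' v) (layerGroup κ v n))) :
    haveI : NeZero (p ^ k) := ⟨pow_ne_zero k (Fact.out : p.Prime).ne_zero⟩
    haveI : NeZero (p ^ (k + 1)) := ⟨pow_ne_zero (k + 1) (Fact.out : p.Prime).ne_zero⟩
    layerPairingH1Of ρM (p ^ (k + 1)) e hμ hadd₁ hadd₂ hgal κ v n x (cohomologyMap (subgroupRepMap gL (layerGroup κ v n)) 1 y') =
      (((layerPairingH1Of ρM' (p ^ k) e' hμ' hadd₁' hadd₂' hgal' κ v n (cohomologyMap (subgroupRepMap fL (layerGroup κ v n)) 1 x) y').val *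
        p : ℕ) : ZMod (p ^ (k + 1))) := by
  haveI : NeZero (p ^ k) := ⟨pow_ne_zero k (Fact.out : p.Prime).ne_zero⟩
  haveI : NeZero (p ^ (k + 1)) := ⟨pow_ne_zero (k + 1) (Fact.out : p.Prime).ne_zero⟩
  rw [layerPairingH1Of_apply, layerPairingH1Of_apply, ← invAt_cohomologyMap_muLocalIncl k v]
  congr 1
  letI : Fintype (absoluteGaloisGroup (v.adicCompletion ℚ) ⧸ layerGroup κ v n) := layerFintypeQuot κ v n
  unfold layerSumPairingOf layerShapiroOf
  exact (shapiroLift_cupProduct_coindFin_map_adjoint (localPairingOfFun ρM' (p ^ k) e' hμ' hadd₁' hadd₂' hgal' v)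
    (localPairingOfFun ρM (p ^ (k + 1)) e hμ hadd₁ hadd₂ hgal v) fL gL (muLocalIncl k v) (layerGroup κ v n)
    (isOpen_layerGroup κ v n) (layerReps_spec κ v n) (layerReps_one κ v n)
    (fun a b' => muLocalIncl_localPairingOfFun k ρM ρM' v fL gL e hμ hadd₁ hadd₂ hgal e' hμ' hadd₁' hadd₂' hgal' hc a b') x y').symm

end Generic

/-! ### §4.3 The `ρ`-instance: H7 for the pin classes `red_{2^k}(X)`, `X ∈ H¹(Γ_m, T_ρ)` (e.g. `X = conj_{σ_c}(proj_m x)`) -/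

section Rho

variable (S : Set (PadicAlgCl 2)) (ρ : FramedGaloisRep ℚ ↥(padicCoeffIntegers S) 2)
  (t₀ : ↥(padicCoeffIntegers S) →+ ℤ_[2]) (ζ : ℕ → AlgebraicClosure ℚ)
  (ePk : ∀ k : ℕ, ↥(AddSubgroup.torsionBy (Cofree ρ ↥(padicCoeffField S)) ((2 ^ k : ℕ) : ℤ)) →
    ↥(AddSubgroup.torsionBy (Cofree ρ ↥(padicCoeffField S)) ((2 ^ k : ℕ) : ℤ)) → AlgebraicClosure ℚ)
  (hμPk : ∀ k a b, ePk k a b ^ (2 ^ k) = 1)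
  (hadd₁Pk : ∀ k a₁ a₂ b, ePk k (a₁ + a₂) b = ePk k a₁ b * ePk k a₂ b)
  (hadd₂Pk : ∀ k a b₁ b₂, ePk k a (b₁ + b₂) = ePk k a b₁ * ePk k a b₂)
  (hgalPk : ∀ k (σ : absoluteGaloisGroup ℚ) (a b : ↥(AddSubgroup.torsionBy (Cofree ρ ↥(padicCoeffField S)) ((2 ^ k : ℕ) : ℤ))),
    σ • ePk k a b = ePk k (cofreeTorsionGaloisModule S ρ _ σ a) (cofreeTorsionGaloisModule S ρ _ σ b))
  (κ : ZpExtension ℚ 2) (w : HeightOneSpectrum (𝓞 ℚ))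
  -- the level-raising maps `ι_k : A_ρ[2^k]|_{Γ_w} ⟶ A_ρ[2^{k+1}]|_{Γ_w}` as DATA with their defining property (the identity on `A_ρ`)
  (ιL : ∀ k : ℕ, cofreeTorsionLocalRep S ρ ((2 ^ k : ℕ) : ℤ) w ⟶ cofreeTorsionLocalRep S ρ ((2 ^ (k + 1) : ℕ) : ℤ) w)
  (hιL : ∀ (k : ℕ) (b' : ↥(AddSubgroup.torsionBy (Cofree ρ ↥(padicCoeffField S)) ((2 ^ k : ℕ) : ℤ))),
    (((ιL k).hom b' : ↥(AddSubgroup.torsionBy (Cofree ρ ↥(padicCoeffField S)) ((2 ^ (k + 1) : ℕ) : ℤ))) : Cofree ρ ↥(padicCoeffField S)) =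
      (b' : Cofree ρ ↥(padicCoeffField S)))

include hιL in
/-- `ι(div_k t) = div_{k+1}(2 t)` in `A_ρ[2^{k+1}]` (from `ι = id` on `A_ρ`). [cite: Kato2004Asterisque, §13.8 (p. 228)] -/
theorem ιL_divPowCofreeMkTorsion (k : ℕ) (t : Fin 2 → ↥(padicCoeffIntegers S)) :
    (ιL k).hom (divPowCofreeMkTorsion S ρ k t) = divPowCofreeMkTorsion S ρ (k + 1) (2 • t) := by
  apply Subtype.ext
  rw [hιL, coe_divPowCofreeMkTorsion_succ_two_nsmul]

include hιL in
/-- The MIXED identity `e_{k+1}(a, ι b') = e_k([2] a, b')` on all of `A_ρ[2^{k+1}] × A_ρ[2^k]`, from the ζ-tower (§2 on representatives).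
[cite: Kato2004Asterisque, §14.9 (p. 239)] -/
theorem ePk_incl_eq_ePk_pow (hζ : ∀ k, IsPrimitiveRoot (ζ k) (2 ^ k)) (he : HePk S ρ t₀ ζ ePk) (hz : ZetaTower ζ) (k : ℕ)
    (a : ↥(AddSubgroup.torsionBy (Cofree ρ ↥(padicCoeffField S)) ((2 ^ (k + 1) : ℕ) : ℤ)))
    (b' : ↥(AddSubgroup.torsionBy (Cofree ρ ↥(padicCoeffField S)) ((2 ^ k : ℕ) : ℤ))) :
    ePk (k + 1) a ((ιL k).hom b') = ePk k ((cofreeTorsionLocalPow S ρ k w).hom a) b' := by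
  obtain ⟨s, rfl⟩ := divPowCofreeMkTorsion_surjective S ρ (k + 1) a
  obtain ⟨t, rfl⟩ := divPowCofreeMkTorsion_surjective S ρ k b'
  rw [ιL_divPowCofreeMkTorsion S ρ w ιL hιL]
  change ePk (k + 1) _ _ = ePk k ((cofreeTorsionPow S ρ k).hom (divPowCofreeMkTorsion S ρ (k + 1) s)) _
  rw [cofreeTorsionPow_divPowCofreeMkTorsion, ePk_succ_incl_eq hζ he hz]

/-- **H7 for `ρ`, `ZMod` currency**: `⟨red_{2^{k+1}} X, ι_* y⟩_{m,2^{k+1}} = 2 · ⟨red_{2^k} X, y⟩_{m,2^k}` for `X ∈ H¹(Γ_m, T_ρ)`, `y ∈ H¹(U_{m,w}, A_ρ[2^k]|)`,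
given the mixed identity (so: given the ζ-tower). Squares: (1)+(2) `layerLocOf_reduce_succ`, (3)(5)(6′) `layerPairingH1Of_incl_compat`.
[cite: Kato2004Asterisque, §13.8 (pp. 228–229)] [cite: PerrinRiou1994Invent, §3.6.1] -/
theorem rhoLayerPairingOf_incl_compat
    (hmix : ∀ k (a : ↥(AddSubgroup.torsionBy (Cofree ρ ↥(padicCoeffField S)) ((2 ^ (k + 1) : ℕ) : ℤ)))
      (b' : ↥(AddSubgroup.torsionBy (Cofree ρ ↥(padicCoeffField S)) ((2 ^ k : ℕ) : ℤ))),
      ePk (k + 1) a ((ιL k).hom b') = ePk k ((cofreeTorsionLocalPow S ρ k w).hom a) b')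
    (m k : ℕ) (X : H1 (FramedGaloisRep.toGaloisRep ρ) (κ.layerSubgroup m))
    (y : continuousCohomology 1 (subgroupRep (localRepOf (cofreeTorsionGaloisModule S ρ ((2 ^ k : ℕ) : ℤ)) w) (layerGroup κ w m))) :
    layerPairingOf (cofreeTorsionGaloisModule S ρ ((2 ^ (k + 1) : ℕ) : ℤ)) (2 ^ (k + 1)) (ePk (k + 1)) (hμPk (k + 1)) (hadd₁Pk (k + 1))
        (hadd₂Pk (k + 1)) (hgalPk (k + 1)) κ w m (reduceH1CofreePkTorsion S ρ (k + 1) (κ.layerSubgroup m) X)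
        (cohomologyMap (subgroupRepMap (ιL k) (layerGroup κ w m)) 1 y) =
      (((layerPairingOf (cofreeTorsionGaloisModule S ρ ((2 ^ k : ℕ) : ℤ)) (2 ^ k) (ePk k) (hμPk k) (hadd₁Pk k) (hadd₂Pk k) (hgalPk k) κ w m
          (reduceH1CofreePkTorsion S ρ k (κ.layerSubgroup m) X) y).val * 2 : ℕ) : ZMod (2 ^ (k + 1))) := by
  -- no `rw` across levels: a FAILED unification `A_ρ[2^k] ≟ A_ρ[2^{k+1}]` unfolds the torsion subtypes (cf. the tree's heartbeat note on
  -- `layerLocOf_reduce_succ`); compose the two equalities by hand instead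
  rw [layerPairingOf_apply, layerPairingOf_apply]
  have h := layerPairingH1Of_incl_compat k (cofreeTorsionGaloisModule S ρ ((2 ^ (k + 1) : ℕ) : ℤ))
    (cofreeTorsionGaloisModule S ρ ((2 ^ k : ℕ) : ℤ)) w (cofreeTorsionLocalPow S ρ k w) (ιL k)
    (ePk (k + 1)) (hμPk (k + 1)) (hadd₁Pk (k + 1)) (hadd₂Pk (k + 1)) (hgalPk (k + 1)) (ePk k) (hμPk k) (hadd₁Pk k) (hadd₂Pk k) (hgalPk k)
    (hmix k) κ m (layerLocOf (cofreeTorsionGaloisModule S ρ ((2 ^ (k + 1) : ℕ) : ℤ)) κ w m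
      (reduceH1CofreePkTorsion S ρ (k + 1) (κ.layerSubgroup m) X)) y
  have h2 := congrArg (fun z => (((layerPairingH1Of (cofreeTorsionGaloisModule S ρ ((2 ^ k : ℕ) : ℤ)) (2 ^ k) (ePk k) (hμPk k) (hadd₁Pk k)
      (hadd₂Pk k) (hgalPk k) κ w m z y).val * 2 : ℕ) : ZMod (2 ^ (k + 1)))) (layerLocOf_reduce_succ S ρ k w κ m X)
  exact h.trans h2.symm

/-- **H7 for `ρ`, in the `ℚ/ℤ` currency of `AwayPins.hlocdS`**: the level-`(k+1)` pin value on `ι_* y` and the level-`k` pin value on `y` are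
the same element of `ℚ/ℤ`. [cite: PerrinRiou1994Invent, §3.6.1] [cite: Kato2004Asterisque, §13.8 (pp. 228–229)] -/
theorem rhoLayerPairingOf_incl_compat_addCircle
    (hmix : ∀ k (a : ↥(AddSubgroup.torsionBy (Cofree ρ ↥(padicCoeffField S)) ((2 ^ (k + 1) : ℕ) : ℤ)))
      (b' : ↥(AddSubgroup.torsionBy (Cofree ρ ↥(padicCoeffField S)) ((2 ^ k : ℕ) : ℤ))),
      ePk (k + 1) a ((ιL k).hom b') = ePk k ((cofreeTorsionLocalPow S ρ k w).hom a) b')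
    (m k : ℕ) (X : H1 (FramedGaloisRep.toGaloisRep ρ) (κ.layerSubgroup m))
    (y : continuousCohomology 1 (subgroupRep (localRepOf (cofreeTorsionGaloisModule S ρ ((2 ^ k : ℕ) : ℤ)) w) (layerGroup κ w m))) :
    (layerPairingOf (cofreeTorsionGaloisModule S ρ ((2 ^ (k + 1) : ℕ) : ℤ)) (2 ^ (k + 1)) (ePk (k + 1)) (hμPk (k + 1)) (hadd₁Pk (k + 1))
        (hadd₂Pk (k + 1)) (hgalPk (k + 1)) κ w m (reduceH1CofreePkTorsion S ρ (k + 1) (κ.layerSubgroup m) X)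
        (cohomologyMap (subgroupRepMap (ιL k) (layerGroup κ w m)) 1 y)).val •
        ((((2 : ℚ) ^ (k + 1))⁻¹ : ℚ) : AddCircle (1 : ℚ)) =
      (layerPairingOf (cofreeTorsionGaloisModule S ρ ((2 ^ k : ℕ) : ℤ)) (2 ^ k) (ePk k) (hμPk k) (hadd₁Pk k) (hadd₂Pk k) (hgalPk k) κ w m
          (reduceH1CofreePkTorsion S ρ k (κ.layerSubgroup m) X) y).val • ((((2 : ℚ) ^ k)⁻¹ : ℚ) : AddCircle (1 : ℚ)) :=
  (val_nsmul_inv_two_pow_eq_iff k _ _).mpr (rhoLayerPairingOf_incl_compat S ρ ePk hμPk hadd₁Pk hadd₂Pk hgalPk κ w ιL hmix m k X y)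

include hιL in
/-- **THE BOTTOM LINE (H7 from the ζ-tower).** With the value formula `hePk` (field of `OnePairPins`) and the compatible roots `ζ_{k+1}² = ζ_k`
(the v3b binder `hζ2`, NOT a field), the `k`-inclusion square of the value pin holds for every `X ∈ H¹(Γ_m, T_ρ)` — in particular for the pin
classes `conj_{σ_c}(proj_m x)` of `AwayPins.hlocdS` — at every place `w`, layer `m`, level `k`.
[cite: PerrinRiou1994Invent, §3.6.1] [cite: Kato2004Asterisque, §13.8 (pp. 228–229), §14.9 (p. 239)] -/
theorem pinInclSquare_of_zetaTower (hζ : ∀ k, IsPrimitiveRoot (ζ k) (2 ^ k)) (he : HePk S ρ t₀ ζ ePk) (hz : ZetaTower ζ)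
    (m k : ℕ) (X : H1 (FramedGaloisRep.toGaloisRep ρ) (κ.layerSubgroup m))
    (y : continuousCohomology 1 (subgroupRep (localRepOf (cofreeTorsionGaloisModule S ρ ((2 ^ k : ℕ) : ℤ)) w) (layerGroup κ w m))) :
    (layerPairingOf (cofreeTorsionGaloisModule S ρ ((2 ^ (k + 1) : ℕ) : ℤ)) (2 ^ (k + 1)) (ePk (k + 1)) (hμPk (k + 1)) (hadd₁Pk (k + 1))
        (hadd₂Pk (k + 1)) (hgalPk (k + 1)) κ w m (reduceH1CofreePkTorsion S ρ (k + 1) (κ.layerSubgroup m) X)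
        (cohomologyMap (subgroupRepMap (ιL k) (layerGroup κ w m)) 1 y)).val •
        ((((2 : ℚ) ^ (k + 1))⁻¹ : ℚ) : AddCircle (1 : ℚ)) =
      (layerPairingOf (cofreeTorsionGaloisModule S ρ ((2 ^ k : ℕ) : ℤ)) (2 ^ k) (ePk k) (hμPk k) (hadd₁Pk k) (hadd₂Pk k) (hgalPk k) κ w m
          (reduceH1CofreePkTorsion S ρ k (κ.layerSubgroup m) X) y).val • ((((2 : ℚ) ^ k)⁻¹ : ℚ) : AddCircle (1 : ℚ)) :=
  rhoLayerPairingOf_incl_compat_addCircle S ρ ePk hμPk hadd₁Pk hadd₂Pk hgalPk κ w ιL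
    (fun k a b' => ePk_incl_eq_ePk_pow S ρ t₀ ζ ePk w ιL hιL hζ he hz k a b') m k X y

end Rho

end InclSquare

end Summit.BirchSwinnertonDyer.BirchSwinnertonDyer.Cruxes.ResidualThetaCountLowerPureAtTwo.SideaK4G19

end
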